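import Literature.AlgebraicGeometry.ModuliOfAbelianVarieties.Lan2013.Sec621Sec622BoundaryChartsBasic
import HarnessLib

/-!
# [Lan2013] §6.2.1 — Holds companion of ★ `Sec621Sec622BoundaryChartsBasic`: Def. 6.2.1.2 «In particular, `Γ_{Φ₁} = Γ_φ`» PROVED

K.-W. Lan, *Arithmetic compactifications of PEL-type Shimura varieties* [Lan2013PELCompactifications], Def. 6.2.1.2 (book p. 377;
2010 rev. p. 422).  The statement file types `Γ_{Φ_n}` as the REAL subgroup `GammaPhiLevel Γφ ϕ₂ ϕ₀` (the elements of `Γ_φ` whose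
`X`-component fixes every `ϕ₋₂ u` by pre-composition and whose `Y`-component fixes every `ϕ₀ w` after base change to the level ring
`R`, intended `R = ℤ/nℤ`).  The print's closing sentence «In particular, `Γ_{Φ₁} = Γ_φ`» is the case `n = 1`, i.e. `R = ℤ/1ℤ = 0`: over a
SUBSINGLETON coefficient ring both level conditions are vacuous.  This companion proves exactly that (cell hodgecm-mathlib, squad TS,
typer TS-t18, row R10a HOLDS pay-down; the sampled reviewer of p849104 checked the same statement in a scratch file).  HC_CM is proved
only modulo the 7 printed citations (2 remaining: hLiu418 = stmt-HodgeConjecture-24832, h413 = stmt-HodgeConjecture-24833) until rung 0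
closes; this file discharges none of them.
-/

namespace Literature.AlgebraicGeometry.ModuliOfAbelianVarieties.Lan2013.Sec621Sec622BoundaryChartsBasic

open scoped TensorProduct

variable {O : Type} [CommRing O]
variable {X Y : Type} [AddCommGroup X] [Module O X] [AddCommGroup Y] [Module O Y]

/-- **Def. 6.2.1.2, last sentence — «In particular, `Γ_{Φ₁} = Γ_φ`»**: at level `n = 1` the coefficient ring `R = ℤ/1ℤ` is the zero
ring, the targets `Hom(X, R)` and `R ⊗_ℤ Y` of the level maps are trivial, both conditions of `GammaPhiLevel` hold for every pair, and
`Γ_{Φ₁} = GammaPhiLevel Γφ ϕ₂ ϕ₀ = Γφ = Γ_φ`.  Stated for any `Subsingleton R`.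
[cite: Lan2013PELCompactifications, Def. 6.2.1.2 (p. 377)] -/
theorem GammaPhiLevel_eq_of_subsingleton (Γφ : Subgroup ((X ≃ₗ[O] X) × (Y ≃ₗ[O] Y))) {R : Type} [CommRing R]
    [Subsingleton R] {G₂ G₀ : Type} [AddCommGroup G₂] [Module R G₂] [AddCommGroup G₀] [Module R G₀]
    (ϕ₂ : G₂ ≃ₗ[R] (X →ₗ[ℤ] R)) (ϕ₀ : G₀ ≃ₗ[R] (R ⊗[ℤ] Y)) : GammaPhiLevel Γφ ϕ₂ ϕ₀ = Γφ := by
  haveI : Subsingleton (R ⊗[ℤ] Y) := Module.subsingleton R _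
  have h : {g : (X ≃ₗ[O] X) × (Y ≃ₗ[O] Y) |
      (∀ u : G₂, ϕ₂ u = (ϕ₂ u) ∘ₗ (g.1.toLinearMap.restrictScalars ℤ)) ∧
        ∀ w : G₀, ϕ₀ w = ((g.2.toLinearMap.restrictScalars ℤ).baseChange R) (ϕ₀ w)} = Set.univ :=
    Set.eq_univ_of_forall fun _ => ⟨fun _ => Subsingleton.elim _ _, fun _ => Subsingleton.elim _ _⟩
  unfold GammaPhiLevel
  rw [h, Subgroup.closure_univ, inf_top_eq]

/-! ## (ED. 2 of this companion) API of the carpet's ED. 3: `RepresentsGrp → Represents`, and the §3 facts under the pinned hypothesis -/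

section Edition3API

open _root_.CategoryTheory _root_.AlgebraicGeometry

variable [StarRing O] [Module.Free ℤ O] [Module.Finite ℤ O]
variable {L : Type} [AddCommGroup L] [Module O L] [Module.Free ℤ L] [Module.Finite ℤ L]
variable {𝓛 : PELTypeOLattice O L} {box : Set ℕ} {𝔐 : 𝓛.FineModuliScheme box 1} {φ : Y →ₗ[O] X}
variable (𝔅 : BoundaryChartAmbient 𝓛 box 𝔐 X Y φ)

/-- The group-law-pinned standing hypothesis `RepresentsGrp` (ED. 3, review p849104 note 5) implies the set-level one `Represents` of §3:
★ `IsGroupRepresentedBy` is `IsRepresentedBy` plus multiplicativity. [cite: Lan2013PELCompactifications, Cor. 6.2.2.3 (p. 380)] -/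
theorem BoundaryChartAmbient.RepresentsGrp.represents (h : 𝔅.RepresentsGrp) : 𝔅.Represents :=
  ⟨h.1.1, h.2.1.1, h.2.2.1.1, h.2.2.2.1⟩

/-- Cor. 6.2.2.3 under the pinned hypothesis: a consumer holding `RepresentsGrp` extracts the conclusion of `Lan2013_6223` (whose
`IsMonHom` clauses then refer to the functor group laws, review p849104 note 5). [cite: Lan2013PELCompactifications, Cor. 6.2.2.3 (p. 380)] -/
theorem BoundaryChartAmbient.Lan2013_6223.of_representsGrp (h6223 : 𝔅.Lan2013_6223) (h : 𝔅.RepresentsGrp) :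
    letI := 𝔅.grpC; letI := 𝔅.grpXAd; letI := 𝔅.grpYA; letI := 𝔅.grpYAd
    IsPullback 𝔅.fst 𝔅.snd 𝔅.resPhi 𝔅.compLam ∧ IsMonHom 𝔅.fst ∧ IsMonHom 𝔅.snd ∧
      IsMonHom 𝔅.resPhi ∧ IsMonHom 𝔅.compLam ∧ IsProper 𝔅.C.hom ∧ Smooth 𝔅.C.hom :=
  h6223 h.represents

end Edition3API

end Literature.AlgebraicGeometry.ModuliOfAbelianVarieties.Lan2013.Sec621Sec622BoundaryChartsBasic
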